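import Mathlib
import Literature.Analysis.FluidPDE.Tao2016AveragedNS.RestartedCascadeFlows
import HarnessLib

/-!
# Profile kit for window certificates in the repaired format K2″ (route `BarrierStepRungThree`),
  part I: the quadratic term shell by shell, and the doubly-exponential profile ABOVE the window

Table-free bookkeeping shared by EVERY certificate in the repaired format of route
`BarrierStepRungThree` (the hypothesis format of `Theorems.BarrierSoundness.barrierSoundness₃` /
`Theorems.noGlobalCascade_of_certificate₃`; items stmt-NavierStokesRegularity-23420 / 23648 / 23942).
That format asks, besides the polynomial clauses about the window, for an OUTSIDE PROFILE `(r, q, ρ)`,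
an envelope `env`, a slack majorant `Ψ` and a tail constant `M₁` subject to infinitely many
inequalities (clauses 14–18, 20).  This part provides:

* `abs_quadTerm_le_three_shell_weighted` — a shell-resolved, coefficient-weighted bound on Tao's
  quadratic term (`(0,0,0)`, `(1,0,0)`, `(0,1,0)` couple shells `n, n+1` at rate `(1+ε₀)^{5n/2}`, the
  pump shift `(0,0,1)` couples shell `n-1` at rate `(1+ε₀)^{5(n-1)/2}`);
* the profile ABOVE the window `K := kLo + n`: `q_{K-1+m} = z₀^{2^m} / (κ 2^{5(K+m)/2})` with
  `κ = 2cA₁`, `z₀ = κ 2^{5K/2} q_top` (so `q_{K-1} = q_top`), `r = q/2`, `ρ = q/(2c)`: the recursion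
  clause 16 holds with equality (`above_recursion`, `above_clause16`), the re-entry decay clause 18
  (`above_clause18`) and the tail constant of clause 20 (`above_clause20`) need only `0 < z₀ ≤ 1/2`,
  and `8^k q_k² / 2 ≤ 2^{-2k}/κ²` (`above_sq_weight_le`, for the slack majorant).

Parts II (`…CertificateProfileBelow`) and III (`…CertificateProfileKit`) add the geometric profile
below the window, the slack majorant and the assembled kit.

HONEST FRAMING: bookkeeping for certificates about Tao-type MODEL lattice pseudo-flows (rung TL-M3);
it constructs no certificate, proves nothing about any table, and says nothing about the Navier–Stokes
equations; no summit is proved by this file.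
-/

noncomputable section

-- the sub-problem namespace repeats the summit name by design (D-0017)
set_option linter.dupNamespace false

namespace Summit.NavierStokesRegularity.NavierStokesRegularity.Theorems

namespace CertificateProfile

open scoped BigOperators
open Literature.Analysis.FluidPDE Literature.Analysis.FluidPDE.TaoCascade

/-! ### A coefficient-weighted, shell-resolved bound on the quadratic term -/

/-- **Shell-resolved, coefficient-weighted size of Tao's quadratic term.** If
`|X_{j,n-1}(t)| ≤ a`, `|X_{j,n}(t)| ≤ b`, `|X_{j,n+1}(t)| ≤ d` for all modes `j` (`a, b, d ≥ 0`), then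
`|quadTerm(X)_{i,n}(t)| ≤ (1+ε₀)^{5n/2} (A₀ b² + Aₓ b d) + (1+ε₀)^{5(n-1)/2} A₁ a²` where
`A₀ = ∑_{i₁,i₂} |α_{i₁ i₂ i,(0,0,0)}|`, `Aₓ = ∑ (|α_{·,(1,0,0)}| + |α_{·,(0,1,0)}|)`, `A₁ = ∑ |α_{·,(0,0,1)}|`:
the shifts `(0,0,0)`, `(1,0,0)`, `(0,1,0)` couple the shells `n, n+1` at the rate `(1+ε₀)^{5n/2}`, the
shift `(0,0,1)` couples the shell `n-1` at the rate `(1+ε₀)^{5(n-1)/2}` (`1 + ε₀ > 0`).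
[cite: Tao2016AveragedNS, §4 (4.8) (the bilinear term on the shift set)] -/
theorem abs_quadTerm_le_three_shell_weighted {m : ℕ} {ε₀ : ℝ} (hε : 0 < 1 + ε₀)
    (α : Fin m → Fin m → Fin m → ℤ × ℤ × ℤ → ℝ)
    (X : Fin m → ℤ → ℝ → ℝ) (i : Fin m) (n : ℤ) (t : ℝ) {a b d : ℝ}
    (ha0 : 0 ≤ a) (hb0 : 0 ≤ b) (hd0 : 0 ≤ d)
    (ha : ∀ j, |X j (n - 1) t| ≤ a) (hb : ∀ j, |X j n t| ≤ b) (hd : ∀ j, |X j (n + 1) t| ≤ d) :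
    |quadTerm ε₀ α X i n t| ≤
      (1 + ε₀) ^ ((5 : ℝ) * n / 2) *
          ((∑ i₁ : Fin m, ∑ i₂ : Fin m, |α i₁ i₂ i (0, 0, 0)|) * (b * b) +
            ((∑ i₁ : Fin m, ∑ i₂ : Fin m, |α i₁ i₂ i (1, 0, 0)|) +
              (∑ i₁ : Fin m, ∑ i₂ : Fin m, |α i₁ i₂ i (0, 1, 0)|)) * (b * d)) +
        (1 + ε₀) ^ ((5 : ℝ) * (n - 1 : ℤ) / 2) *
          ((∑ i₁ : Fin m, ∑ i₂ : Fin m, |α i₁ i₂ i (0, 0, 1)|) * (a * a)) := by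
  -- generic term bound: |α w (y z)| ≤ |α| w (P Q)
  have hgen : ∀ (c e y z : ℝ) {P Q : ℝ}, |y| ≤ P → |z| ≤ Q → 0 ≤ P →
      |c * (1 + ε₀) ^ e * (y * z)| ≤ |c| * (1 + ε₀) ^ e * (P * Q) := by
    intro c e y z P Q hy hz hP
    have hq : 0 ≤ (1 + ε₀) ^ e := (Real.rpow_pos_of_pos hε _).le
    rw [abs_mul, abs_mul, abs_mul, abs_of_nonneg hq]
    have h1 : |y| * |z| ≤ P * Q := mul_le_mul hy hz (abs_nonneg _) hP
    exact mul_le_mul_of_nonneg_left h1 (mul_nonneg (abs_nonneg _) hq)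
  have hcast : ((5 : ℝ) * ((n : ℝ) - 1) / 2) = ((5 : ℝ) * (n - 1 : ℤ) / 2) := by push_cast; ring
  -- the inner sum over the shift set, for fixed modes
  have hinner : ∀ i₁ i₂ : Fin m,
      |∑ μ ∈ shiftSet, α i₁ i₂ i μ * (1 + ε₀) ^ ((5 : ℝ) * (n - μ.2.2) / 2) *
          (X i₁ (n - μ.2.2 + μ.1) t * X i₂ (n - μ.2.2 + μ.2.1) t)| ≤
        (1 + ε₀) ^ ((5 : ℝ) * n / 2) *
            (|α i₁ i₂ i (0, 0, 0)| * (b * b) +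
              (|α i₁ i₂ i (1, 0, 0)| + |α i₁ i₂ i (0, 1, 0)|) * (b * d)) +
          (1 + ε₀) ^ ((5 : ℝ) * (n - 1 : ℤ) / 2) * (|α i₁ i₂ i (0, 0, 1)| * (a * a)) := by
    intro i₁ i₂
    rw [shiftSet, Finset.sum_insert (by decide), Finset.sum_insert (by decide),
      Finset.sum_insert (by decide), Finset.sum_singleton]
    simp only [sub_zero, add_zero, Int.cast_zero, Int.cast_one]
    have t0 := hgen (α i₁ i₂ i (0, 0, 0)) ((5 : ℝ) * n / 2) (X i₁ n t) (X i₂ n t) (hb i₁) (hb i₂) hb0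
    have t1 := hgen (α i₁ i₂ i (1, 0, 0)) ((5 : ℝ) * n / 2) (X i₁ (n + 1) t) (X i₂ n t)
      (hd i₁) (hb i₂) hd0
    have t2 := hgen (α i₁ i₂ i (0, 1, 0)) ((5 : ℝ) * n / 2) (X i₁ n t) (X i₂ (n + 1) t)
      (hb i₁) (hd i₂) hb0
    have t3 := hgen (α i₁ i₂ i (0, 0, 1)) ((5 : ℝ) * (n - 1 : ℤ) / 2) (X i₁ (n - 1) t)
      (X i₂ (n - 1) t) (ha i₁) (ha i₂) ha0
    rw [hcast]
    have key : ∀ w x y z : ℝ, |w + (x + (y + z))| ≤ |w| + |x| + |y| + |z| := by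
      intro w x y z
      have h1 := abs_add_le w (x + (y + z))
      have h2 := abs_add_le x (y + z)
      have h3 := abs_add_le y z
      linarith
    refine le_trans (key _ _ _ _) ?_
    have hq : 0 ≤ (1 + ε₀) ^ ((5 : ℝ) * n / 2) := (Real.rpow_pos_of_pos hε _).le
    nlinarith [t0, t1, t2, t3, mul_comm b d]
  unfold quadTerm
  calc |∑ i₁, ∑ i₂, ∑ μ ∈ shiftSet, α i₁ i₂ i μ * (1 + ε₀) ^ ((5 : ℝ) * (n - μ.2.2) / 2) *
          (X i₁ (n - μ.2.2 + μ.1) t * X i₂ (n - μ.2.2 + μ.2.1) t)|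
      ≤ ∑ i₁, |∑ i₂, ∑ μ ∈ shiftSet, α i₁ i₂ i μ * (1 + ε₀) ^ ((5 : ℝ) * (n - μ.2.2) / 2) *
          (X i₁ (n - μ.2.2 + μ.1) t * X i₂ (n - μ.2.2 + μ.2.1) t)| :=
        Finset.abs_sum_le_sum_abs _ _
    _ ≤ ∑ i₁, ∑ i₂, |∑ μ ∈ shiftSet, α i₁ i₂ i μ * (1 + ε₀) ^ ((5 : ℝ) * (n - μ.2.2) / 2) *
          (X i₁ (n - μ.2.2 + μ.1) t * X i₂ (n - μ.2.2 + μ.2.1) t)| :=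
        Finset.sum_le_sum fun i₁ _ => Finset.abs_sum_le_sum_abs _ _
    _ ≤ ∑ i₁ : Fin m, ∑ i₂ : Fin m,
          ((1 + ε₀) ^ ((5 : ℝ) * n / 2) *
              (|α i₁ i₂ i (0, 0, 0)| * (b * b) +
                (|α i₁ i₂ i (1, 0, 0)| + |α i₁ i₂ i (0, 1, 0)|) * (b * d)) +
            (1 + ε₀) ^ ((5 : ℝ) * (n - 1 : ℤ) / 2) * (|α i₁ i₂ i (0, 0, 1)| * (a * a))) :=
        Finset.sum_le_sum fun i₁ _ => Finset.sum_le_sum fun i₂ _ => hinner i₁ i₂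
    _ = _ := by
        simp only [Finset.mul_sum, Finset.sum_mul, ← Finset.sum_add_distrib]


/-! ### Small numeric facts -/

/-- `10 m ≤ 14 + 2^{m+1}` for every natural number `m`. [folklore] -/
theorem ten_mul_le_fourteen_add_two_pow (m : ℕ) : 10 * m ≤ 14 + 2 ^ (m + 1) := by
  have key : ∀ j : ℕ, 10 * (j + 3) ≤ 14 + 2 ^ (j + 4) := by
    intro j
    induction j with
    | zero => norm_num
    | succ j ih =>
      have h16 : 16 ≤ 2 ^ (j + 4) := by
        calc (16 : ℕ) = 2 ^ 4 := by norm_num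
          _ ≤ 2 ^ (j + 4) := Nat.pow_le_pow_right (by norm_num) (by omega)
      have : 2 ^ (j + 1 + 4) = 2 * 2 ^ (j + 4) := by ring
      omega
  rcases Nat.lt_or_ge m 3 with hm | hm
  · interval_cases m <;> norm_num
  · obtain ⟨j, rfl⟩ := Nat.exists_eq_add_of_le hm
    have := key j
    rw [show 3 + j = j + 3 by ring, show j + 3 + 1 = j + 4 by ring]
    exact this

/-- `2^{10 m} · (1/2)^{2^{m+1}} ≤ 2^{14}`: the doubly-exponential profile beats the weight `2^{10k}` of
the a-priori regularity clause (4.5). [folklore] -/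
theorem two_pow_ten_mul_half_pow_le (m : ℕ) :
    (2 : ℝ) ^ (10 * m) * (1 / 2 : ℝ) ^ (2 ^ (m + 1)) ≤ 2 ^ 14 := by
  have h := ten_mul_le_fourteen_add_two_pow m
  have h1 : (2 : ℝ) ^ (10 * m) ≤ 2 ^ (14 + 2 ^ (m + 1)) := pow_le_pow_right₀ (by norm_num) h
  have h2 : (0 : ℝ) < 2 ^ (2 ^ (m + 1)) := by positivity
  rw [pow_add] at h1
  rw [one_div, inv_pow]
  calc (2 : ℝ) ^ (10 * m) * ((2 : ℝ) ^ 2 ^ (m + 1))⁻¹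
      ≤ 2 ^ 14 * 2 ^ 2 ^ (m + 1) * ((2 : ℝ) ^ 2 ^ (m + 1))⁻¹ :=
        mul_le_mul_of_nonneg_right h1 (inv_nonneg.2 h2.le)
    _ = 2 ^ 14 := by field_simp

/-- `2^{a} · 2^{b} = 2^{a+b}` for real exponents (base `2 > 0`). [folklore] -/
theorem two_rpow_add (a b : ℝ) : (2 : ℝ) ^ (a + b) = (2 : ℝ) ^ a * (2 : ℝ) ^ b :=
  Real.rpow_add (by norm_num) a b

/-- `(2^{a})^j = 2^{j a}` for a natural power of a real power of `2`. [folklore] -/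
theorem two_rpow_pow (a : ℝ) (j : ℕ) : ((2 : ℝ) ^ a) ^ j = (2 : ℝ) ^ ((j : ℝ) * a) := by
  rw [← Real.rpow_natCast, ← Real.rpow_mul (by norm_num : (0 : ℝ) ≤ 2), mul_comm]

/-! ### The doubly-exponential profile above the window -/

section Above

variable {κ z₀ : ℝ} {K : ℤ} {q : ℤ → ℝ}

/-- Positivity of the upper profile `q_k = z₀^{2^{k-K+1}} / (κ 2^{5(k+1)/2})` (`κ, z₀ > 0`). [folklore] -/
theorem above_pos (hκ : 0 < κ) (hz : 0 < z₀)
    (hq : ∀ k, K - 1 ≤ k →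
      q k = z₀ ^ (2 ^ (k - K + 1).toNat) / (κ * (2 : ℝ) ^ ((5 : ℝ) * ((k : ℝ) + 1) / 2)))
    {k : ℤ} (hk : K - 1 ≤ k) : 0 < q k := by
  rw [hq k hk]
  exact div_pos (pow_pos hz _) (mul_pos hκ (Real.rpow_pos_of_pos (by norm_num) _))

/-- The upper profile at the top window shell: `q_{K-1} = z₀ / (κ 2^{5K/2})`. [folklore] -/
theorem above_at_top
    (hq : ∀ k, K - 1 ≤ k →
      q k = z₀ ^ (2 ^ (k - K + 1).toNat) / (κ * (2 : ℝ) ^ ((5 : ℝ) * ((k : ℝ) + 1) / 2))) :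
    q (K - 1) = z₀ / (κ * (2 : ℝ) ^ ((5 : ℝ) * (K : ℝ) / 2)) := by
  rw [hq (K - 1) le_rfl]
  have h0 : (K - 1 - K + 1).toNat = 0 := by simp
  rw [h0, pow_zero, pow_one]
  congr 2
  push_cast
  ring

/-- **The recursion of the upper profile**: `q_k = κ · 2^{5(k-1)/2} · q_{k-1}²` for `k ≥ K` — with
`κ = 2cA₁` this is clause 16 (`2^{5(k-1)/2} A₁ q_{k-1}² ≤ ρ_k = q_k/(2c)`) with equality. [folklore] -/
theorem above_recursion (hκ : 0 < κ)
    (hq : ∀ k, K - 1 ≤ k →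
      q k = z₀ ^ (2 ^ (k - K + 1).toNat) / (κ * (2 : ℝ) ^ ((5 : ℝ) * ((k : ℝ) + 1) / 2)))
    {k : ℤ} (hk : K ≤ k) :
    q k = κ * (2 : ℝ) ^ ((5 : ℝ) * ((k - 1 : ℤ) : ℝ) / 2) * q (k - 1) ^ 2 := by
  rw [hq k (by omega), hq (k - 1) (by omega)]
  have hm : (k - K + 1).toNat = (k - 1 - K + 1).toNat + 1 := by omega
  rw [hm, pow_succ, pow_mul]
  set P : ℝ := (2 : ℝ) ^ ((5 : ℝ) * ((k - 1 : ℤ) : ℝ) / 2) with hP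
  have hP0 : 0 < P := Real.rpow_pos_of_pos (by norm_num) _
  have e1 : (2 : ℝ) ^ ((5 : ℝ) * (((k - 1 : ℤ) : ℝ) + 1) / 2) = P * (2 : ℝ) ^ ((5 : ℝ) / 2) := by
    rw [hP, ← two_rpow_add]; congr 1; ring
  have e2 : (2 : ℝ) ^ ((5 : ℝ) * ((k : ℝ) + 1) / 2) = P * (2 : ℝ) ^ (5 : ℝ) := by
    rw [hP, ← two_rpow_add]; congr 1; push_cast; ring
  have e3 : ((2 : ℝ) ^ ((5 : ℝ) / 2)) ^ 2 = (2 : ℝ) ^ (5 : ℝ) := by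
    rw [two_rpow_pow]; norm_num
  have h5 : (0 : ℝ) < (2 : ℝ) ^ (5 : ℝ) := Real.rpow_pos_of_pos (by norm_num) _
  have h52 : (0 : ℝ) < (2 : ℝ) ^ ((5 : ℝ) / 2) := Real.rpow_pos_of_pos (by norm_num) _
  rw [e1, e2, div_pow, mul_pow, mul_pow, e3]
  field_simp

/-- **Clause 16 with the upper profile**: for `k ≥ K`, `2^{5(k-1)/2} · A · q_{k-1}² ≤ q_k / (2c)`
whenever `A ≤ A₁` and `κ = 2 c A₁`. [cite: Tao2016AveragedNS, §4 (4.8) (the pump rate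
`(1+ε₀)^{5(n-1)/2}` of the shift `(0,0,1)`)] -/
theorem above_clause16 {c A A₁ : ℝ} (hc : 0 < c) (hA : A ≤ A₁) (hκ : κ = 2 * c * A₁) (hκ0 : 0 < κ)
    (hq : ∀ k, K - 1 ≤ k →
      q k = z₀ ^ (2 ^ (k - K + 1).toNat) / (κ * (2 : ℝ) ^ ((5 : ℝ) * ((k : ℝ) + 1) / 2)))
    {k : ℤ} (hk : K ≤ k) :
    (2 : ℝ) ^ ((5 : ℝ) * ((k - 1 : ℤ) : ℝ) / 2) * A * q (k - 1) ^ 2 ≤ q k / (2 * c) := by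
  rw [above_recursion hκ0 hq hk, hκ]
  have h2 : 0 ≤ (2 : ℝ) ^ ((5 : ℝ) * ((k - 1 : ℤ) : ℝ) / 2) * q (k - 1) ^ 2 := by positivity
  rw [show 2 * c * A₁ * (2 : ℝ) ^ ((5 : ℝ) * ((k - 1 : ℤ) : ℝ) / 2) * q (k - 1) ^ 2 / (2 * c) =
    A₁ * ((2 : ℝ) ^ ((5 : ℝ) * ((k - 1 : ℤ) : ℝ) / 2) * q (k - 1) ^ 2) by field_simp]
  calc (2 : ℝ) ^ ((5 : ℝ) * ((k - 1 : ℤ) : ℝ) / 2) * A * q (k - 1) ^ 2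
      = A * ((2 : ℝ) ^ ((5 : ℝ) * ((k - 1 : ℤ) : ℝ) / 2) * q (k - 1) ^ 2) := by ring
    _ ≤ A₁ * ((2 : ℝ) ^ ((5 : ℝ) * ((k - 1 : ℤ) : ℝ) / 2) * q (k - 1) ^ 2) :=
        mul_le_mul_of_nonneg_right hA h2

/-- **Clause 18 with the upper profile**: for `k ≥ K`, `q_{k+1} ≤ 2^{-θ} · (q_k / 2)` provided
`0 < z₀ ≤ 1/2` and `θ ≤ 1/2` (in fact `κ 2^{5k/2} q_k = z₀^{2^{k-K+1}} 2^{-5/2} ≤ 2^{-9/2}`).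
[cite: Tao2016AveragedNS, §6.2 Prop. 6.3 (vi)–(ix) (the re-entry ratio `(1+ε₀)^{-θ}`)] -/
theorem above_clause18 {θ : ℝ} (hθ : θ ≤ 1 / 2) (hκ : 0 < κ) (hz : 0 < z₀) (hz2 : z₀ ≤ 1 / 2)
    (hq : ∀ k, K - 1 ≤ k →
      q k = z₀ ^ (2 ^ (k - K + 1).toNat) / (κ * (2 : ℝ) ^ ((5 : ℝ) * ((k : ℝ) + 1) / 2)))
    {k : ℤ} (hk : K ≤ k) :
    q (k + 1) ≤ (1 + 1 : ℝ) ^ (-θ) * (q k / 2) := by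
  have hrec := above_recursion hκ hq (show K ≤ k + 1 by omega)
  rw [show k + 1 - 1 = k by ring] at hrec
  rw [hrec, show (1 + 1 : ℝ) = 2 by norm_num]
  have hqk : 0 < q k := above_pos hκ hz hq (by omega)
  -- κ 2^{5k/2} q k = z₀^{2^{m+1}} / 2^{5/2}
  have hval : κ * (2 : ℝ) ^ ((5 : ℝ) * ((k : ℤ) : ℝ) / 2) * q k =
      z₀ ^ (2 ^ (k - K + 1).toNat) / (2 : ℝ) ^ ((5 : ℝ) / 2) := by
    rw [hq k (by omega)]
    have e2 : (2 : ℝ) ^ ((5 : ℝ) * ((k : ℝ) + 1) / 2) =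
        (2 : ℝ) ^ ((5 : ℝ) * ((k : ℤ) : ℝ) / 2) * (2 : ℝ) ^ ((5 : ℝ) / 2) := by
      rw [← two_rpow_add]; congr 1; ring
    have hp : (0 : ℝ) < (2 : ℝ) ^ ((5 : ℝ) * ((k : ℤ) : ℝ) / 2) :=
      Real.rpow_pos_of_pos (by norm_num) _
    rw [e2]
    field_simp
  have hm : 2 ≤ 2 ^ (k - K + 1).toNat := by
    calc 2 = 2 ^ 1 := by norm_num
      _ ≤ 2 ^ (k - K + 1).toNat := Nat.pow_le_pow_right (by norm_num) (by omega)
  have hzpow : z₀ ^ (2 ^ (k - K + 1).toNat) ≤ z₀ ^ 2 :=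
    pow_le_pow_of_le_one hz.le (by linarith) hm
  have hz2' : z₀ ^ 2 ≤ 1 / 4 := by nlinarith
  have h52 : (4 : ℝ) ≤ (2 : ℝ) ^ ((5 : ℝ) / 2) := by
    calc (4 : ℝ) = (2 : ℝ) ^ (2 : ℝ) := by norm_num
      _ ≤ (2 : ℝ) ^ ((5 : ℝ) / 2) := Real.rpow_le_rpow_of_exponent_le (by norm_num) (by norm_num)
  have hθ' : (1 / 2 : ℝ) ≤ (2 : ℝ) ^ (-θ) := by
    calc (1 / 2 : ℝ) = (2 : ℝ) ^ (-1 : ℝ) := by norm_num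
      _ ≤ (2 : ℝ) ^ (-θ) := Real.rpow_le_rpow_of_exponent_le (by norm_num) (by linarith)
  -- the key product bound
  have hkey : κ * (2 : ℝ) ^ ((5 : ℝ) * ((k : ℤ) : ℝ) / 2) * q k ≤ 1 / 16 := by
    rw [hval, div_le_iff₀ (by positivity)]
    nlinarith [pow_nonneg hz.le (2 ^ (k - K + 1).toNat)]
  calc κ * (2 : ℝ) ^ ((5 : ℝ) * ((k : ℤ) : ℝ) / 2) * q k ^ 2
      = (κ * (2 : ℝ) ^ ((5 : ℝ) * ((k : ℤ) : ℝ) / 2) * q k) * q k := by ring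
    _ ≤ (1 / 16) * q k := mul_le_mul_of_nonneg_right hkey hqk.le
    _ ≤ (2 : ℝ) ^ (-θ) * (q k / 2) := by nlinarith

/-- **Clause 20 with the upper profile** (the a-priori regularity weight (4.5)): for `0 < z₀ ≤ 1/2`
the numbers `(1 + 2^{10k}) q_k`, `k ≥ K`, are bounded. [cite: Tao2016AveragedNS, §4 Lemma 4.1 (4.5)] -/
theorem above_clause20 (hκ : 0 < κ) (hz : 0 < z₀) (hz2 : z₀ ≤ 1 / 2)
    (hq : ∀ k, K - 1 ≤ k →
      q k = z₀ ^ (2 ^ (k - K + 1).toNat) / (κ * (2 : ℝ) ^ ((5 : ℝ) * ((k : ℝ) + 1) / 2))) :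
    ∃ M₁ : ℝ, ∀ k : ℤ, K ≤ k → (1 + (1 + 1 : ℝ) ^ ((10 : ℝ) * (k : ℝ))) * q k ≤ M₁ := by
  refine ⟨(1 + (2 : ℝ) ^ ((10 : ℝ) * (K : ℝ)) * 2 ^ 14) / (κ * (2 : ℝ) ^ ((5 : ℝ) * ((K : ℝ) + 1) / 2)),
    fun k hk => ?_⟩
  rw [show (1 + 1 : ℝ) = 2 by norm_num, hq k (by omega)]
  obtain ⟨m, hm⟩ : ∃ m : ℕ, k = K + m := ⟨(k - K).toNat, by omega⟩
  have hmn : (k - K + 1).toNat = m + 1 := by omega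
  rw [hmn]
  have hden : κ * (2 : ℝ) ^ ((5 : ℝ) * ((K : ℝ) + 1) / 2) ≤
      κ * (2 : ℝ) ^ ((5 : ℝ) * ((k : ℝ) + 1) / 2) := by
    refine mul_le_mul_of_nonneg_left (Real.rpow_le_rpow_of_exponent_le (by norm_num) ?_) hκ.le
    have : (K : ℝ) ≤ k := by exact_mod_cast hk
    linarith
  have hdenpos : 0 < κ * (2 : ℝ) ^ ((5 : ℝ) * ((K : ℝ) + 1) / 2) :=
    mul_pos hκ (Real.rpow_pos_of_pos (by norm_num) _)
  have hzle : z₀ ^ (2 ^ (m + 1)) ≤ (1 / 2 : ℝ) ^ (2 ^ (m + 1)) := pow_le_pow_left₀ hz.le hz2 _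
  have hz1 : z₀ ^ (2 ^ (m + 1)) ≤ 1 := pow_le_one₀ hz.le (by linarith)
  have hsplit : (2 : ℝ) ^ ((10 : ℝ) * (k : ℝ)) =
      (2 : ℝ) ^ ((10 : ℝ) * (K : ℝ)) * (2 : ℝ) ^ (10 * m) := by
    rw [hm]; push_cast
    rw [show (10 : ℝ) * ((K : ℝ) + (m : ℝ)) = 10 * (K : ℝ) + ((10 * m : ℕ) : ℝ) by push_cast; ring,
      two_rpow_add, Real.rpow_natCast]
  have hnum : (1 + (2 : ℝ) ^ ((10 : ℝ) * (k : ℝ))) * z₀ ^ (2 ^ (m + 1)) ≤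
      1 + (2 : ℝ) ^ ((10 : ℝ) * (K : ℝ)) * 2 ^ 14 := by
    rw [hsplit, add_mul, one_mul]
    have h14 := two_pow_ten_mul_half_pow_le m
    have hK0 : 0 ≤ (2 : ℝ) ^ ((10 : ℝ) * (K : ℝ)) := (Real.rpow_pos_of_pos (by norm_num) _).le
    have : (2 : ℝ) ^ ((10 : ℝ) * (K : ℝ)) * (2 : ℝ) ^ (10 * m) * z₀ ^ (2 ^ (m + 1)) ≤
        (2 : ℝ) ^ ((10 : ℝ) * (K : ℝ)) * 2 ^ 14 := by
      rw [mul_assoc]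
      refine mul_le_mul_of_nonneg_left ?_ hK0
      exact (mul_le_mul_of_nonneg_left hzle (by positivity)).trans h14
    linarith
  calc (1 + (2 : ℝ) ^ ((10 : ℝ) * (k : ℝ))) *
        (z₀ ^ (2 ^ (m + 1)) / (κ * (2 : ℝ) ^ ((5 : ℝ) * ((k : ℝ) + 1) / 2)))
      = (1 + (2 : ℝ) ^ ((10 : ℝ) * (k : ℝ))) * z₀ ^ (2 ^ (m + 1)) /
          (κ * (2 : ℝ) ^ ((5 : ℝ) * ((k : ℝ) + 1) / 2)) := by
        ring
    _ ≤ (1 + (2 : ℝ) ^ ((10 : ℝ) * (K : ℝ)) * 2 ^ 14) /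
          (κ * (2 : ℝ) ^ ((5 : ℝ) * ((k : ℝ) + 1) / 2)) :=
        div_le_div_of_nonneg_right hnum (hdenpos.le.trans hden)
    _ ≤ (1 + (2 : ℝ) ^ ((10 : ℝ) * (K : ℝ)) * 2 ^ 14) /
          (κ * (2 : ℝ) ^ ((5 : ℝ) * ((K : ℝ) + 1) / 2)) :=
        div_le_div_of_nonneg_left (by positivity) hdenpos hden

/-- For `k ≥ K - 1` the squared upper profile times the slack weight `8^{k}` is at most `2^{-2k}/κ²`
(used for the slack majorant; only `0 < z₀ ≤ 1` is needed). [folklore] -/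
theorem above_sq_weight_le (hκ : 0 < κ) (hz : 0 < z₀) (hz1 : z₀ ≤ 1)
    (hq : ∀ k, K - 1 ≤ k →
      q k = z₀ ^ (2 ^ (k - K + 1).toNat) / (κ * (2 : ℝ) ^ ((5 : ℝ) * ((k : ℝ) + 1) / 2)))
    {k : ℤ} (hk : K - 1 ≤ k) :
    (2 : ℝ) ^ ((3 : ℝ) * (k : ℝ)) * (q k ^ 2 / 2) ≤ (2 : ℝ) ^ (-(2 : ℝ) * (k : ℝ)) / κ ^ 2 := by
  rw [hq k hk]
  have hz1' : z₀ ^ (2 ^ (k - K + 1).toNat) ≤ 1 := pow_le_one₀ hz.le hz1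
  have hz0' : 0 ≤ z₀ ^ (2 ^ (k - K + 1).toNat) := pow_nonneg hz.le _
  have hD : (0 : ℝ) < (2 : ℝ) ^ ((5 : ℝ) * ((k : ℝ) + 1) / 2) := Real.rpow_pos_of_pos (by norm_num) _
  have hsq : ((2 : ℝ) ^ ((5 : ℝ) * ((k : ℝ) + 1) / 2)) ^ 2 = (2 : ℝ) ^ ((5 : ℝ) * (k : ℝ) + 5) := by
    rw [two_rpow_pow]; congr 1; push_cast; ring
  -- 2^{3k} = 2^{-2k} · 2^{-5} · 2^{5k+5}
  have hw : (2 : ℝ) ^ ((3 : ℝ) * (k : ℝ)) = (2 : ℝ) ^ (-(2 : ℝ) * (k : ℝ)) * (2 : ℝ) ^ (-(5 : ℝ)) *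
      (2 : ℝ) ^ ((5 : ℝ) * (k : ℝ) + 5) := by
    rw [← two_rpow_add, ← two_rpow_add]; congr 1; ring
  have hA : 0 < (2 : ℝ) ^ (-(2 : ℝ) * (k : ℝ)) := Real.rpow_pos_of_pos (by norm_num) _
  have hB : 0 < (2 : ℝ) ^ ((5 : ℝ) * (k : ℝ) + 5) := Real.rpow_pos_of_pos (by norm_num) _
  have h5' : 0 ≤ (2 : ℝ) ^ (-(5 : ℝ)) := (Real.rpow_pos_of_pos (by norm_num) _).le
  have h5 : (2 : ℝ) ^ (-(5 : ℝ)) ≤ 1 :=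
    Real.rpow_le_one_of_one_le_of_nonpos (by norm_num) (by norm_num)
  rw [div_pow, mul_pow, hsq, hw]
  rw [show (2 : ℝ) ^ (-(2 : ℝ) * (k : ℝ)) * (2 : ℝ) ^ (-(5 : ℝ)) * (2 : ℝ) ^ ((5 : ℝ) * (k : ℝ) + 5) *
      ((z₀ ^ (2 ^ (k - K + 1).toNat)) ^ 2 / (κ ^ 2 * (2 : ℝ) ^ ((5 : ℝ) * (k : ℝ) + 5)) / 2) =
      (2 : ℝ) ^ (-(2 : ℝ) * (k : ℝ)) / κ ^ 2 *
        ((2 : ℝ) ^ (-(5 : ℝ)) * (z₀ ^ (2 ^ (k - K + 1).toNat)) ^ 2 / 2) by field_simp]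
  have hlast : (2 : ℝ) ^ (-(5 : ℝ)) * (z₀ ^ (2 ^ (k - K + 1).toNat)) ^ 2 / 2 ≤ 1 := by
    have : (z₀ ^ (2 ^ (k - K + 1).toNat)) ^ 2 ≤ 1 := pow_le_one₀ hz0' hz1'
    nlinarith
  calc (2 : ℝ) ^ (-(2 : ℝ) * (k : ℝ)) / κ ^ 2 *
        ((2 : ℝ) ^ (-(5 : ℝ)) * (z₀ ^ (2 ^ (k - K + 1).toNat)) ^ 2 / 2)
      ≤ (2 : ℝ) ^ (-(2 : ℝ) * (k : ℝ)) / κ ^ 2 * 1 :=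
        mul_le_mul_of_nonneg_left hlast (by positivity)
    _ = _ := mul_one _

end Above

end CertificateProfile

end Summit.NavierStokesRegularity.NavierStokesRegularity.Theorems

end
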